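import Mathlib
import Summits.Ventures.PercRepro2.Defs
import Summits.Ventures.PercRepro2.Graph

/-!
# Root-pair separation: the definitions (blind cell PercRepro2, mine-2 g21; proofs/MINE2-CUTU.md §10)

`IsRootPairSep ends a₁ a₂ V₁ V₂`: the two roots separate the vertex set into the sides `V₁`, `V₂`
(both roots on both sides, nothing else on both, every edge inside one side); `side₁ ends V₁`: the
edges lying inside `V₁`.  The theorems (conditional independence of the two sides given
`{a₁ ↮ a₂}`, and the three zero / nonnegativity cases of the cleared L-half of the weighted (PM))
are in `RootPairSep.lean`.
-/

namespace Summit.Ventures.PercRepro2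

namespace RootPairSep

variable {V : Type*} {E : Type*}

/-- The roots `a₁, a₂` separate the vertex set into the two sides `V₁`, `V₂`: both roots lie
on both sides, nothing else does, and every edge lies inside one side. -/
def IsRootPairSep (ends : E → Sym2 V) (a₁ a₂ : V) (V₁ V₂ : Set V) : Prop :=
  a₁ ∈ V₁ ∩ V₂ ∧ a₂ ∈ V₁ ∩ V₂ ∧ V₁ ∩ V₂ ⊆ {a₁, a₂} ∧
    ∀ e x y, ends e = s(x, y) → (x ∈ V₁ ∧ y ∈ V₁) ∨ (x ∈ V₂ ∧ y ∈ V₂)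

namespace IsRootPairSep

variable {ends : E → Sym2 V} {a₁ a₂ : V} {V₁ V₂ : Set V}

/-- `a₁` lies on both sides. -/
lemma a₁_mem (hs : IsRootPairSep ends a₁ a₂ V₁ V₂) : a₁ ∈ V₁ ∩ V₂ := hs.1
/-- `a₂` lies on both sides. -/
lemma a₂_mem (hs : IsRootPairSep ends a₁ a₂ V₁ V₂) : a₂ ∈ V₁ ∩ V₂ := hs.2.1
/-- Only the roots lie on both sides. -/
lemma inter_sub (hs : IsRootPairSep ends a₁ a₂ V₁ V₂) : V₁ ∩ V₂ ⊆ {a₁, a₂} := hs.2.2.1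
/-- Every edge lies inside one side. -/
lemma edge_side (hs : IsRootPairSep ends a₁ a₂ V₁ V₂) :
    ∀ e x y, ends e = s(x, y) → (x ∈ V₁ ∧ y ∈ V₁) ∨ (x ∈ V₂ ∧ y ∈ V₂) := hs.2.2.2

end IsRootPairSep

/-- The edges lying inside `V₁`. -/
def side₁ (ends : E → Sym2 V) (V₁ : Set V) : Set E :=
  {e | ∀ x y, ends e = s(x, y) → x ∈ V₁ ∧ y ∈ V₁}


end RootPairSep

end Summit.Ventures.PercRepro2
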